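import Summits.ABC.ABC.Theses.IneffectiveSubspace
import Summits.ABC.ABC.Theorems.IneffectiveSubspaceDeepRegimeABCCensusCellNine18A
import Summits.ABC.ABC.Theorems.IneffectiveSubspaceDeepRegimeABCCensusCellNine18B
import Summits.ABC.ABC.Theorems.IneffectiveSubspaceDeepRegimeABCCensusCellNine18C
import Summits.ABC.ABC.Theorems.IneffectiveSubspaceDeepRegimeABCCensusCellNine18D
import Summits.ABC.ABC.Theorems.IneffectiveSubspaceDeepRegimeABCCensusCellEightD
import Literature.NumberTheory.DiophantineGeometry.AbcDepthCensusChunked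

/-!
# `DeepRegimeABC` (stmt-ABC-15121): certified census — the cell `ω₅ ≥ 9` does not meet `c ≤ 10¹⁸` (E, assembly)

Compute-certificate (line leads `prover-line-stmt-ABC-15121-c2-0` / `-c3-0`, 2026-08-16; human
certificate objective) for the crux `Summit.ABC.ABC.Theses.IneffectiveSubspace.DeepRegimeABC` (abc with
exponent `1 + ε` on the deep tail `{ω₅(abc) ≥ K(ε)}`, `ω₅(n) := #{p : p⁵ ∣ n}`), with the chunked
soundness-proved checker `Literature.NumberTheory.DiophantineGeometry.DepthCensus.checkCellChunk`
(`AbcDepthCensusChunked.lean`, `depth_lt_of_checkCellChunks`).  Fifth and last file of the certificate;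
the chunk runs `n9chunk_*` of the 13-chunk cover `S₁₃` of depth 2 live in `…CensusCellNine18{A,B,C,D}.lean`
and (the last two) here; this file assembles the runs over the cover `S₁₃` (`coversAll_S8` of
`…CensusCellEightD.lean`, the same thirteen prefixes)
(`n9chunks_all`) and draws the conclusion.  Sharpens `…CensusDeepTailOddA.lean` (lead c2-0: the cell
`ω₅ ≥ 9` does not meet `c ≤ 10¹⁷`) by one decade; the box has `19 624 830` depth patterns
(`1.26·10⁸` outer steps), re-counted by the independent C mirror `cert/deep_census.c` of lead c3-0's
folder (every chunk size of the table in file C reproduced exactly).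

**Certified here.**  No depth pattern of nine primes has a lattice candidate
`A ∣ a, B ∣ b, C ∣ a + b ≤ 10¹⁸` at all (`depth_le_eight_of_le_tenPow18`: **`ω₅(abc) ≤ 8` for every abc
triple with `c ≤ 10¹⁸`**), hence (`tenPow18_lt_of_nine_le_depth`) **the cell `{ω₅ ≥ 9}` lies in
`{c > 10¹⁸}`** — the even decade for `K = 9`, one past `tenPow_lt_of_le_depth_odd` (`c > 10¹⁷`).  With
`le_of_eight_le_depth` (`…CensusCellEightD.lean`: the cell `ω₅ ≥ 8` begins at `c₈ = 23115230230115023`)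
the profile of first members reads `log₁₀ c_K ≈ 1.5, 2.4, 3.7, 5.8, 8.4, 10.6, 12.9, 16.4, > 18`
(`K = 1, …, 9`).

The only computations trusted to the compiler are the closed `Bool` equations `checkCellChunk … = true`
(13 chunks, `native_decide`, computational certificate lane) and the cover check `coversAll_S8`
(`decide`, imported); everything else is kernel-checked.
-/

-- `Summit.<Summit>.<Problem>` is the mandated summit-side namespace (CONVENTIONS §2); for the
-- single-conjunct summit `ABC` the two coincide, so the duplicate `ABC.ABC` is deliberate.
set_option linter.dupNamespace false

namespace Summit.ABC.ABC.Theorems.DeepRegimeABC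

open Literature.NumberTheory.DiophantineGeometry
open Literature.NumberTheory.DiophantineGeometry.DepthCensus

/-! ## The last two chunk runs -/

/-- Chunk `[3, 2]` of the cell `ω₅ ≥ 9` in the box `c ≤ 10¹⁸` (2 153 264 patterns, 13 175 084 outer steps): no
lattice candidate. [folklore] -/
theorem n9chunk_32 : checkCellChunk (10 ^ 18) 3981 9 [3, 2] (fun _ _ _ => false) = true := by
  native_decide

/-- Chunk `[3, 3]` of the cell `ω₅ ≥ 9` in the box `c ≤ 10¹⁸` (1 986 406 patterns, 12 304 568 outer steps): no
lattice candidate. [folklore] -/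
theorem n9chunk_33 : checkCellChunk (10 ^ 18) 3981 9 [3, 3] (fun _ _ _ => false) = true := by
  native_decide

/-! ## The assembled run over the cover `S₁₃` -/

/-- Every chunk of `S₁₃` accepts the always-failing test (the thirteen runs of files A–E): the cell
`ω₅ ≥ 9` has no lattice candidate in the box `c ≤ 10¹⁸`. [folklore] -/
theorem n9chunks_all : ∀ s ∈ ([[0], [1, 0], [1, 1], [1, 2], [1, 3], [2, 0], [2, 1], [2, 2], [2, 3], [3, 0], [3, 1], [3, 2], [3, 3]] : List (List (Fin 4))),
    checkCellChunk (10 ^ 18) 3981 9 s (fun _ _ _ => false) = true := by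
  intro s hs
  simp only [List.mem_cons, List.mem_nil_iff, or_false] at hs
  rcases hs with rfl | rfl | rfl | rfl | rfl | rfl | rfl | rfl | rfl | rfl | rfl | rfl | rfl
  exacts [n9chunk_0, n9chunk_10, n9chunk_11, n9chunk_12, n9chunk_13, n9chunk_20, n9chunk_21, n9chunk_22,
    n9chunk_23, n9chunk_30, n9chunk_31, n9chunk_32, n9chunk_33]

/-! ## No abc triple of depth `≥ 9` with `c ≤ 10¹⁸` -/

/-- **`ω₅(abc) ≤ 8` for every abc triple with `c ≤ 10¹⁸`** (`3982⁵ > 10¹⁸`). [folklore] -/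
theorem depth_le_eight_of_le_tenPow18 {a b c : ℕ} (habc : IsABCTriple a b c) (hc : c ≤ 10 ^ 18) :
    ((a * b * c).primeFactors.filter (fun p => 5 ≤ (a * b * c).factorization p)).card ≤ 8 :=
  Nat.le_of_lt_succ (depth_lt_of_checkCellChunks (by norm_num) coversAll_S8 n9chunks_all habc hc)

/-- **The cell `ω₅ ≥ 9` lies in `{c > 10¹⁸}`.** [folklore] -/
theorem tenPow18_lt_of_nine_le_depth {a b c : ℕ} (habc : IsABCTriple a b c)
    (hK : 9 ≤ ((a * b * c).primeFactors.filter (fun p => 5 ≤ (a * b * c).factorization p)).card) :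
    10 ^ 18 < c := by
  by_contra h
  exact absurd (hK.trans (depth_le_eight_of_le_tenPow18 habc (not_lt.mp h))) (by norm_num)

/-- The even decades for `K = 8, 9`: **`ω₅(abc) ≥ 8 ⟹ c > 10¹⁶`** (indeed `c ≥ c₈ = 23115230230115023`,
`…CensusCellEightD.lean`) **and `ω₅(abc) ≥ 9 ⟹ c > 10¹⁸`**, i.e. `c > 10^(2K)` for `K ∈ {8, 9}`.
[folklore] -/
theorem tenPow_two_mul_lt_of_le_depth {a b c K : ℕ} (habc : IsABCTriple a b c) (h8 : 8 ≤ K) (h9 : K ≤ 9)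
    (hK : K ≤ ((a * b * c).primeFactors.filter (fun p => 5 ≤ (a * b * c).factorization p)).card) :
    10 ^ (2 * K) < c := by
  interval_cases K
  · exact lt_of_lt_of_le (by norm_num) (le_of_eight_le_depth habc hK)
  · exact tenPow18_lt_of_nine_le_depth habc hK

/-! ## Registered certificate stub of the crux item (stmt-ABC-15121) -/

/-- **Registered certificate `censusCellNine18`** (crux `DeepRegimeABC`, line SketchIdeator5R2, human
certificate objective): the deep cell `{ω₅ ≥ 9}` contains no abc triple with `c ≤ 10¹⁸`. [folklore] -/
theorem censusCellNine18 : (∀ a b c : ℕ, Literature.NumberTheory.DiophantineGeometry.IsABCTriple a b c → c ≤ 10 ^ 18 → ((a * b * c).primeFactors.filter (fun p => 5 ≤ (a * b * c).factorization p)).card ≤ 8) ∧ (∀ a b c : ℕ, Literature.NumberTheory.DiophantineGeometry.IsABCTriple a b c → 9 ≤ ((a * b * c).primeFactors.filter (fun p => 5 ≤ (a * b * c).factorization p)).card → 10 ^ 18 < c) :=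
  ⟨fun _ _ _ h hc => depth_le_eight_of_le_tenPow18 h hc, fun _ _ _ h hK => tenPow18_lt_of_nine_le_depth h hK⟩

end Summit.ABC.ABC.Theorems.DeepRegimeABC
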